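import Mathlib.Analysis.InnerProductSpace.PiL2
import Mathlib.Analysis.Convex.Star
import Mathlib.Analysis.Normed.Module.Convex

/-!
# SmoothPoincare4 / SullivanDual — crux `Target` (stmt-SmoothPoincare4-7823), stub `helper_starConvex_ball_diff_halfPlane`

Flat geometry for the second Mayer–Vietoris step in the computation
`H²_dR(punctured chart 4-ball) = 0`: the open ball `ball c r ⊆ ℝ⁴` with the closed half-plane
`{(y - c) 0 = (y - c) 1 = 0, σ (y - c) 2 ≤ 0}` removed is star-shaped with respect to the point
`a = c + (σ r / 2) e₂` (`σ = ±1`).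

Proof.  For `y` in the set and `t₁, t₂ ≥ 0`, `t₁ + t₂ = 1`, the point `q = t₁ a + t₂ y` lies in
the ball by convexity (`a` is at distance `r / 2` from `c`), and
`q - c = t₁ (a - c) + t₂ (y - c)` with `(a - c) 0 = (a - c) 1 = 0`, `(a - c) 2 = σ r / 2`.
If `(y - c) 0 ≠ 0` (or `(y - c) 1 ≠ 0`) and `t₂ ≠ 0` the same coordinate of `q - c` is
`t₂ (y - c) 0 ≠ 0`; if `t₂ = 0` then `q = a` and `σ (q - c) 2 = r / 2 > 0`.  If both vanish then
`σ (y - c) 2 > 0` and `σ (q - c) 2 = t₁ r / 2 + t₂ σ (y - c) 2 > 0`.  [folklore]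
-/

noncomputable section

-- the registered namespace `Summit.SmoothPoincare4.SmoothPoincare4.Theorems` repeats a component
set_option linter.dupNamespace false

open Set Metric

namespace Summit.SmoothPoincare4.SmoothPoincare4.Theorems

namespace SullivanDual

/-- **Star-shapedness of a ball minus a closed coordinate half-plane.**  For `σ = ±1` and
`0 < r`, the set of points `y ∈ ball c r ⊆ ℝ⁴` with `0 < σ (y - c) 2` or `(y - c) 0 ≠ 0` or
`(y - c) 1 ≠ 0` (the ball with the closed half-plane
`{(y - c) 0 = (y - c) 1 = 0, σ (y - c) 2 ≤ 0}` removed) is star-convex with respect to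
`c + (σ r / 2) e₂`. [folklore] -/
theorem helper_starConvex_ball_diff_halfPlane (c : EuclideanSpace ℝ (Fin 4)) {r σ : ℝ}
    (hr : 0 < r) (hσ : σ = 1 ∨ σ = -1) :
    StarConvex ℝ (c + (σ * (r / 2)) • EuclideanSpace.single (2 : Fin 4) (1 : ℝ))
      {y : EuclideanSpace ℝ (Fin 4) | y ∈ Metric.ball c r ∧
        (0 < σ * (y - c) 2 ∨ (y - c) 0 ≠ 0 ∨ (y - c) 1 ≠ 0)} := by
  -- `σ² = 1`
  have hσ2 : σ * σ = 1 := by rcases hσ with rfl | rfl <;> norm_num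
  have hσabs : |σ| = 1 := by rcases hσ with rfl | rfl <;> norm_num
  set a : EuclideanSpace ℝ (Fin 4) :=
    c + (σ * (r / 2)) • EuclideanSpace.single (2 : Fin 4) (1 : ℝ) with ha_def
  -- `a - c = (σ r / 2) e₂`
  have hac : a - c = (σ * (r / 2)) • EuclideanSpace.single (2 : Fin 4) (1 : ℝ) := by
    rw [ha_def, add_sub_cancel_left]
  -- `a ∈ ball c r`
  have ha_ball : a ∈ Metric.ball c r := by
    rw [Metric.mem_ball, dist_eq_norm, hac, norm_smul, PiLp.norm_single, Real.norm_eq_abs,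
      abs_mul, hσabs, one_mul, norm_one, mul_one, abs_of_pos (half_pos hr)]
    exact half_lt_self hr
  -- coordinates of `a - c`
  have hac0 : (a - c) 0 = 0 := by
    rw [hac, PiLp.smul_apply, PiLp.single_eq_of_ne _ (by decide : (0 : Fin 4) ≠ 2), smul_zero]
  have hac1 : (a - c) 1 = 0 := by
    rw [hac, PiLp.smul_apply, PiLp.single_eq_of_ne _ (by decide : (1 : Fin 4) ≠ 2), smul_zero]
  have hac2 : (a - c) 2 = σ * (r / 2) := by
    rw [hac, PiLp.smul_apply, PiLp.single_eq_same, smul_eq_mul, mul_one]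
  intro y hy t₁ t₂ ht₁ ht₂ hsum
  obtain ⟨hy_ball, hy_or⟩ := hy
  refine ⟨convex_ball c r ha_ball hy_ball ht₁ ht₂ hsum, ?_⟩
  -- coordinates of `q - c`, `q = t₁ a + t₂ y`
  have hq : t₁ • a + t₂ • y - c = t₁ • (a - c) + t₂ • (y - c) := by
    calc t₁ • a + t₂ • y - c = t₁ • a + t₂ • y - (t₁ + t₂) • c := by rw [hsum, one_smul]
      _ = t₁ • (a - c) + t₂ • (y - c) := by rw [add_smul, smul_sub, smul_sub]; abel
  have hqi : ∀ i, (t₁ • a + t₂ • y - c) i = t₁ * (a - c) i + t₂ * (y - c) i := by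
    intro i
    rw [hq, PiLp.add_apply, PiLp.smul_apply, PiLp.smul_apply, smul_eq_mul, smul_eq_mul]
  rw [hqi 0, hqi 1, hqi 2, hac0, hac1, hac2, mul_zero, zero_add, zero_add]
  -- `σ (q - c) 2 = t₁ r / 2 + t₂ σ (y - c) 2`
  have hq2 : σ * (t₁ * (σ * (r / 2)) + t₂ * (y - c) 2) =
      t₁ * (r / 2) * (σ * σ) + t₂ * (σ * (y - c) 2) := by ring
  rw [hq2, hσ2, mul_one]
  have ht₁r : 0 ≤ t₁ * (r / 2) := mul_nonneg ht₁ (half_pos hr).le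
  rcases eq_or_ne t₂ 0 with h0 | h0
  · -- `t₂ = 0`: `q = a` and `σ (q - c) 2 = r / 2 > 0`
    subst h0
    have ht₁1 : t₁ = 1 := by linarith
    subst ht₁1
    left
    linarith [half_pos hr]
  · have ht₂pos : 0 < t₂ := lt_of_le_of_ne ht₂ h0.symm
    rcases hy_or with h2 | h01 | h1
    · left
      have ht₂y : 0 < t₂ * (σ * (y - c) 2) := mul_pos ht₂pos h2
      linarith
    · right; left
      exact mul_ne_zero h0 h01
    · right; right
      exact mul_ne_zero h0 h1
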